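import Summits.BirchSwinnertonDyer.BirchSwinnertonDyer.Theorems.SignedLowerHalvesSmallImageLowerHalfBothSignsRttCharRoadE2JunctionShaSocket
import HarnessLib

/-!
# Route `SignedLowerHalves`, crux L `SmallImageLowerHalfBothSigns` (stmt-BirchSwinnertonDyer-23599), line `rtt_w3` v29 — row S3α (`stub_junctionSha_ns`), LEAD g14:
# THE Ш-SEQUENCE SOCKET WITHOUT TORSION / FINITENESS HYPOTHESES ON `𝐇²_{Iw}` AND ON `Ш²`

WHY (LEAD `cruxlead-stmt-BirchSwinnertonDyer-23599` g14 audit of the S3α glue, DESIGN memo `Lines/rtt_w3-DESIGN-S3alpha-lead-g13.md`). The registered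
row S3α is `λ(H²₂/T₁) ≤ λ(Y′)`; its kernel glue so far was the socket `lambdaInvariant_le_of_sha_sequence(_restrictScalars)` (p782347), which asks that
`G = 𝐇²_{Iw,P}(K_∞, T*)` (honda's `I₂.H`) and `Sh = Ш²_P(T*)` be FINITELY GENERATED TORSION `Λ`-modules — a weak-Leopoldt-type input that no brick of
the design delivers. It is not needed. With `e : Y2 ↪ G` injective, `ρ : G → Loc` with FINITE range and `π : Y → G` with `ker ρ ≤ range π`
(`Y = Y′` finitely generated torsion — lambda-p1 p807937-lineage `…StrictDualFinite`), one has
`λ(Y2) = λ(ker (ρ ∘ e))` (finite index: `Y2 ⧸ ker(ρ∘e) ↪ range ρ`), `ker (ρ ∘ e) ↪ ker ρ ≤ range π` and `range π` is f.g. torsion as an image of `Y`, so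
`λ(Y2) ≤ λ(range π) ≤ λ(Y)`. Consequences for the brick table of S3α: α3 (`Ш² → 𝐇² → Loc` exact) is TAUTOLOGICAL (`Sh := ker ρ`), and NO finiteness /
torsion statement about `𝐇²_{Iw}` or `Ш²` is ever required; the Galois inputs are exactly α1 (`e` injective), α2 (`range ρ` finite, (R)) and the
Poitou–Tate containment `ker ρ ≤ range π` (α5′).

* `isTorsion_range_of_isTorsion` — the range of a linear map out of a torsion module is torsion;
* ★★ `lambdaInvariant_le_of_sha_range` — `e` injective, `range ρ` finite, `ker ρ ≤ range π`, `Y` f.g. torsion ⟹ `λ(Y2) ≤ λ(Y)` (plain `Λ`);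
* `lambdaInvariant_le_of_sha_sequence_free` — the p782347 signature with the four hypotheses on `G`/`Sh` DROPPED (`i : Sh → G`, `Exact i ρ`, `π : Y ↠ Sh`);
* `…_restrictScalars` forms for `Λ_𝒪`-linear maps between modules with scalar-tower `Λ`-structures (the currency of the registered stub).

THEOREMS ONLY (kernel commutative algebra; `--supports stmt-BirchSwinnertonDyer-23599` helper); closes nothing; crux L, crux M, S3α and BSD remain OPEN and are
proved for NO curve by any of this. [cite: Washington1997, §13.2] [cite: NeukirchSchmidtWingberg2008, Ch. VIII §6 (8.6.10) (Poitou–Tate sequence)] [folklore]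
-/

set_option autoImplicit false
-- the Theorems namespace of this sub repeats the summit name by design (D-0017 nested layout)
set_option linter.dupNamespace false

noncomputable section

open Literature.NumberTheory.EllipticCurves

namespace Summit.BirchSwinnertonDyer.BirchSwinnertonDyer.Theorems.SmallImageRttCharRoad

universe u₁ u₂ u₃ u₄ u₅

variable {p : ℕ} [Fact p.Prime]

/-! ## §1 Plain `Λ`-currency -/

section Lambda

variable {Y2 : Type u₁} {G : Type u₂} {Sh : Type u₃} {Loc : Type u₄} {Y : Type u₅}
  [AddCommGroup Y2] [Module (IwasawaAlgebra p) Y2] [AddCommGroup G] [Module (IwasawaAlgebra p) G]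
  [AddCommGroup Sh] [Module (IwasawaAlgebra p) Sh] [AddCommGroup Loc] [Module (IwasawaAlgebra p) Loc]
  [AddCommGroup Y] [Module (IwasawaAlgebra p) Y]

omit [Fact p.Prime] in
/-- The range of a linear map out of a torsion module is torsion (the same non-zero-divisor kills the image). [folklore] -/
theorem isTorsion_range_of_isTorsion {R : Type*} [CommRing R] {M : Type*} {N : Type*} [AddCommGroup M] [Module R M]
    [AddCommGroup N] [Module R N] (π : M →ₗ[R] N) (hM : Module.IsTorsion R M) :
    Module.IsTorsion R (LinearMap.range π) := by
  rintro ⟨y, x, rfl⟩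
  obtain ⟨a, ha⟩ := @hM x
  refine ⟨a, ?_⟩
  ext
  change ((a : R) • π x) = 0
  rw [← map_smul]
  change π ((a : R) • x) = 0
  rw [show (a : R) • x = 0 from ha, map_zero]

/-- **`λ(Y2) = λ(ker (ρ ∘ e))` when `range ρ` is finite**: the inclusion `ker (ρ ∘ e) ↪ Y2` has finite cokernel `Y2 ⧸ ker(ρ∘e) ≅ range (ρ∘e) ≤ range ρ`.
No hypothesis on `G`. [cite: Washington1997, §13.2] [folklore] -/
theorem lambdaInvariant_ker_comp_eq_of_finite_range (e : Y2 →ₗ[IwasawaAlgebra p] G) (ρ : G →ₗ[IwasawaAlgebra p] Loc)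
    (hρ : Finite (LinearMap.range ρ)) :
    lambdaInvariant p (LinearMap.ker (ρ ∘ₗ e)) = lambdaInvariant p Y2 := by
  refine lambdaInvariant_ker_eq_of_finite_range (ρ ∘ₗ e) ?_
  have hle : LinearMap.range (ρ ∘ₗ e) ≤ LinearMap.range ρ := LinearMap.range_comp_le_range e ρ
  exact Finite.of_injective _ (Submodule.inclusion_injective hle)

/-- ★★ **The Ш-sequence socket, containment form, NO hypotheses on `G` or on `ker ρ`.** `Λ`-modules `Y2` (= `H²₂/T₁`), `G` (= `𝐇²_{Iw,P}(K_∞,T*)`),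
`Loc` (= `⊕_{w∈P} 𝐇²_{Iw}(K_w,T*)`), `Y` (= `Y′ = Sel_str^∨`); maps `e : Y2 ↪ G` injective, `ρ : G → Loc` with `range ρ` finite, `π : Y → G` with
`ker ρ ≤ range π` (Poitou–Tate: every everywhere-locally-trivial class comes from the strict Selmer dual), `Y` f.g. torsion. Then `λ(Y2) ≤ λ(Y)`.
[cite: Washington1997, §13.2] [cite: NeukirchSchmidtWingberg2008, Ch. VIII §6 (8.6.10)] -/
theorem lambdaInvariant_le_of_sha_range (e : Y2 →ₗ[IwasawaAlgebra p] G) (he : Function.Injective e)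
    (ρ : G →ₗ[IwasawaAlgebra p] Loc) (hρ : Finite (LinearMap.range ρ))
    (π : Y →ₗ[IwasawaAlgebra p] G) (hπ : LinearMap.ker ρ ≤ LinearMap.range π)
    [Module.Finite (IwasawaAlgebra p) Y] (hY : Module.IsTorsion (IwasawaAlgebra p) Y) :
    lambdaInvariant p Y2 ≤ lambdaInvariant p Y := by
  -- step 1: `λ(Y2) = λ(ker (ρ ∘ e))`
  rw [← lambdaInvariant_ker_comp_eq_of_finite_range e ρ hρ]
  -- step 2: `e` restricts to an injection `ker (ρ ∘ e) ↪ range π`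
  have hmem : ∀ x : LinearMap.ker (ρ ∘ₗ e), e (x : Y2) ∈ LinearMap.range π := by
    intro x
    apply hπ
    rw [LinearMap.mem_ker]
    have hx := x.2
    rw [LinearMap.mem_ker, LinearMap.comp_apply] at hx
    exact hx
  let f : LinearMap.ker (ρ ∘ₗ e) →ₗ[IwasawaAlgebra p] LinearMap.range π :=
    LinearMap.codRestrict (LinearMap.range π) (e ∘ₗ (LinearMap.ker (ρ ∘ₗ e)).subtype) (fun x ↦ hmem x)
  have hf : Function.Injective f := by
    intro x y hxy
    have h1 : e (x : Y2) = e (y : Y2) := by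
      have := congrArg (fun z : LinearMap.range π ↦ (z : G)) hxy
      simpa [f] using this
    exact Subtype.ext (he h1)
  -- step 3: `range π` is f.g. torsion as an image of `Y`
  have hT : Module.IsTorsion (IwasawaAlgebra p) (LinearMap.range π) := isTorsion_range_of_isTorsion π hY
  exact (lambdaInvariant_le_of_injective_of_isTorsion f hf hT).trans (lambdaInvariant_range_le π hY)

/-- Variant with `Loc` itself finite. [cite: Washington1997, §13.2] -/
theorem lambdaInvariant_le_of_sha_range_of_finite (e : Y2 →ₗ[IwasawaAlgebra p] G) (he : Function.Injective e)
    (ρ : G →ₗ[IwasawaAlgebra p] Loc) [Finite Loc]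
    (π : Y →ₗ[IwasawaAlgebra p] G) (hπ : LinearMap.ker ρ ≤ LinearMap.range π)
    [Module.Finite (IwasawaAlgebra p) Y] (hY : Module.IsTorsion (IwasawaAlgebra p) Y) :
    lambdaInvariant p Y2 ≤ lambdaInvariant p Y :=
  lambdaInvariant_le_of_sha_range e he ρ (Finite.of_injective _ (LinearMap.range ρ).subtype_injective) π hπ hY

/-- ★★ **The Ш-sequence socket (row S3α / J4) FREE OF HYPOTHESES ON `G` AND `Sh`** — the signature of p782347 `lambdaInvariant_le_of_sha_sequence` with
`[Module.Finite Λ G]`, `hG`, `[Module.Finite Λ Sh]`, `hSh` DROPPED: `e : Y2 ↪ G` injective, `i : Sh → G`, `ρ : G → Loc` exact at `G` with `range ρ` finite,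
`π : Y ↠ Sh` surjective with `Y` f.g. torsion. Then `λ(Y2) ≤ λ(Y)`. [cite: Washington1997, §13.2] [cite: NeukirchSchmidtWingberg2008, Ch. VIII §6 (8.6.10)] -/
theorem lambdaInvariant_le_of_sha_sequence_free (e : Y2 →ₗ[IwasawaAlgebra p] G) (he : Function.Injective e)
    (i : Sh →ₗ[IwasawaAlgebra p] G) (ρ : G →ₗ[IwasawaAlgebra p] Loc) (hex : Function.Exact i ρ) (hρ : Finite (LinearMap.range ρ))
    (π : Y →ₗ[IwasawaAlgebra p] Sh) (hπ : Function.Surjective π) [Module.Finite (IwasawaAlgebra p) Y]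
    (hY : Module.IsTorsion (IwasawaAlgebra p) Y) :
    lambdaInvariant p Y2 ≤ lambdaInvariant p Y := by
  refine lambdaInvariant_le_of_sha_range e he ρ hρ (i ∘ₗ π) (fun x hx ↦ ?_) hY
  rw [LinearMap.range_comp_of_range_eq_top i (LinearMap.range_eq_top.mpr hπ), ← LinearMap.exact_iff.mp hex]
  exact hx

end Lambda

/-! ## §2 `Λ_𝒪`-linear maps with scalar-tower `Λ`-structures -/

section LambdaO

variable {S : Set (PadicAlgCl p)} [Algebra (IwasawaAlgebra p) (IwasawaAlgebraO S)]
  {Y2 : Type u₁} {G : Type u₂} {Sh : Type u₃} {Loc : Type u₄} {Y : Type u₅}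
  [AddCommGroup Y2] [Module (IwasawaAlgebraO S) Y2] [Module (IwasawaAlgebra p) Y2] [IsScalarTower (IwasawaAlgebra p) (IwasawaAlgebraO S) Y2]
  [AddCommGroup G] [Module (IwasawaAlgebraO S) G] [Module (IwasawaAlgebra p) G] [IsScalarTower (IwasawaAlgebra p) (IwasawaAlgebraO S) G]
  [AddCommGroup Sh] [Module (IwasawaAlgebraO S) Sh] [Module (IwasawaAlgebra p) Sh] [IsScalarTower (IwasawaAlgebra p) (IwasawaAlgebraO S) Sh]
  [AddCommGroup Loc] [Module (IwasawaAlgebraO S) Loc] [Module (IwasawaAlgebra p) Loc] [IsScalarTower (IwasawaAlgebra p) (IwasawaAlgebraO S) Loc]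
  [AddCommGroup Y] [Module (IwasawaAlgebraO S) Y] [Module (IwasawaAlgebra p) Y] [IsScalarTower (IwasawaAlgebra p) (IwasawaAlgebraO S) Y]

omit [Module (IwasawaAlgebraO S) Sh] [Module (IwasawaAlgebra p) Sh] [IsScalarTower (IwasawaAlgebra p) (IwasawaAlgebraO S) Sh] in
/-- ★★ **Containment form for `Λ_𝒪`-linear maps** (restriction of scalars to `Λ`): `e` injective, `range ρ` finite, `ker ρ ≤ range π`, `Y` f.g. torsion over `Λ`
⟹ `λ(Y2) ≤ λ(Y)`. The currency of the registered stub `stub_junctionSha_ns` (honda's `I₂.H`, the degree-2 semilocal data, lambda-p1's `Y′`).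
[cite: Washington1997, §13.2] [cite: NeukirchSchmidtWingberg2008, Ch. VIII §6 (8.6.10)] -/
theorem lambdaInvariant_le_of_sha_range_restrictScalars (e : Y2 →ₗ[IwasawaAlgebraO S] G) (he : Function.Injective e)
    (ρ : G →ₗ[IwasawaAlgebraO S] Loc) (hρ : Finite (LinearMap.range ρ))
    (π : Y →ₗ[IwasawaAlgebraO S] G) (hπ : LinearMap.ker ρ ≤ LinearMap.range π)
    [Module.Finite (IwasawaAlgebra p) Y] (hY : Module.IsTorsion (IwasawaAlgebra p) Y) :
    lambdaInvariant p Y2 ≤ lambdaInvariant p Y := by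
  refine lambdaInvariant_le_of_sha_range (e.restrictScalars (IwasawaAlgebra p)) he (ρ.restrictScalars (IwasawaAlgebra p)) ?_
    (π.restrictScalars (IwasawaAlgebra p)) ?_ hY
  · have hr : (LinearMap.range (ρ.restrictScalars (IwasawaAlgebra p)) : Set Loc) = LinearMap.range ρ := by
      ext x; simp only [SetLike.mem_coe, LinearMap.mem_range, LinearMap.coe_restrictScalars]
    exact (Set.finite_coe_iff.mpr ((Set.finite_coe_iff.mp hρ).subset hr.symm.subset))
  · intro x hx
    rw [LinearMap.mem_ker, LinearMap.coe_restrictScalars] at hx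
    have hx' : x ∈ LinearMap.range π := hπ (LinearMap.mem_ker.mpr hx)
    obtain ⟨y, rfl⟩ := hx'
    exact ⟨y, rfl⟩

omit [Module (IwasawaAlgebra p) Sh] [IsScalarTower (IwasawaAlgebra p) (IwasawaAlgebraO S) Sh] in
/-- ★★ **The Ш-sequence socket for `Λ_𝒪`-linear maps FREE OF HYPOTHESES ON `G` AND `Sh`** (p782347 `…_restrictScalars` minus four hypotheses).
[cite: Washington1997, §13.2] [cite: NeukirchSchmidtWingberg2008, Ch. VIII §6 (8.6.10)] -/
theorem lambdaInvariant_le_of_sha_sequence_free_restrictScalars (e : Y2 →ₗ[IwasawaAlgebraO S] G) (he : Function.Injective e)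
    (i : Sh →ₗ[IwasawaAlgebraO S] G) (ρ : G →ₗ[IwasawaAlgebraO S] Loc) (hex : Function.Exact i ρ) (hρ : Finite (LinearMap.range ρ))
    (π : Y →ₗ[IwasawaAlgebraO S] Sh) (hπ : Function.Surjective π) [Module.Finite (IwasawaAlgebra p) Y]
    (hY : Module.IsTorsion (IwasawaAlgebra p) Y) :
    lambdaInvariant p Y2 ≤ lambdaInvariant p Y := by
  refine lambdaInvariant_le_of_sha_range_restrictScalars e he ρ hρ (i ∘ₗ π) (fun x hx ↦ ?_) hY
  rw [LinearMap.range_comp_of_range_eq_top i (LinearMap.range_eq_top.mpr hπ), ← LinearMap.exact_iff.mp hex]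
  exact hx

end LambdaO

end Summit.BirchSwinnertonDyer.BirchSwinnertonDyer.Theorems.SmallImageRttCharRoad
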